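import Summits.QuantumFields.YangMills.Theorems.BalabanUVNodesN24K1OfChildrenSplitNoShrinkLettersWorldBuilt
import Summits.QuantumFields.YangMills.Theorems.BalabanUVNodesK1NodeOLadderRunwiseSlackUniform

/-!
# NODE N24 (B2) — NODE O's LETTER FAMILIES AT THE K1⁷ WITNESS DOOR: THE WHOLE LADDER's DOWNWARD EDGES BY NAME, CHILD-FREE
# positive box floor (Part 23 `hOF`) ⟹ sign (Part 27 `hsignF`) ⟹ run-wise partial-sum floor (Part 26 `hpsF`) ⟹ slack-uniform no-shrink `L*` (dag-n24-w1 III) ⟹ no-halving (Part 30 `hnhF`)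
# ⟹ ∃-factor no-shrink (Part 31 `hnsF`, the bottom rung the typed DAG reads) — so that EVERY NODE-O currency of record reaches EVERY closer edition (the RS-keyed Parts 23–31 and the
# «P₂C» + mixed-W Part 32) by ONE application, and the ladder Part 31's header lists is tree text edge by edge

TRACK A (YM-PLAN §2d, node N24 of 28 = binder B2), seat `pub-ymgap-dag-n24-c` (R134 fan-out seat, strategy s2; gen 10, Part 33 = 39H).  Key of record: K1⁷ `StabilityBAtRecordR13SepCoPH` =
stmt-QuantumFields-20542; this file `--supports` it as a helper (Summits lane; advisory).
WHY.  The closers of record display NODE O as ONE letter FAMILY over the witness door (`∀ {j c} {γ ε₀ ε₂₉ B₃ B₃' a₀ a₁} (door hypotheses) {bl β'} (box letters), ∃ …`); each Part chose one rung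
(23: positive floor; 27: sign; 26: PS floor; 30: no-halving; 31∕32: ∃-factor no-shrink).  The EDGES between the rungs are elementary (floor monotonicity; Part 26's `psFloor_zero_of_betaLowerH_zero`;
dag-n24-w1's `exists_noShrink_of_psFloor` ∕ `slackUniformNoShrink_of_psFloor` ∕ `exists_noHalving_of_slackUniformNoShrink`, p610312 ∕ p613002; the slack `β₀ := 1`) but were applied INLINE
inside individual closers (Part 27 l.307, Part 30 §1′) or only at the generic `HBeta` level (dag-n24-w1).  After Part 32 re-keyed N05 (P₂C) and N12 (mixed W-pin), a consumer holding a STRONGER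
NODE-O letter (box floor ∕ sign ∕ PS ∕ `L*` ∕ no-halving) needs the family-level edge to reach Part 32's no-shrink closer WITHOUT a re-keyed twin of every older road: this file supplies all of
them, CHILD-FREE (neither N05's slot nor N12's pin nor any world appears), hence valid for every edition at once.  Part 31 §5 already holds no-halving ⟹ no-shrink and PS ⟹ {no-halving,
no-shrink}; here: edge 1 box floor ⟹ sign, edge 2 sign ⟹ PS, edge 3 PS ⟹ `L*`, edge 4∕4′ `L*` ⟹ no-halving ∕ no-shrink, and the composites sign ⟹ no-shrink, box floor ⟹ no-shrink.
SEPARATIONS (each converse fails, even inside K0's two-sided box) are dag-n24-w1's kernel models (`K1NodeOLadderRunwiseSeparations`, `…SlackUniform` §2) — not restated; P3 n°89 `psFloor_not_sign`.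
CAVEAT OF RECORD (ym-nodeO-idea-8 g11): in the printed-shape class `β_k = a + r_k`, `|r_k| ≤ c g_k²`, all rungs are equivalent to the averaged asymptotic-freedom SIGN `a > 0`.
A NEW importing module (Part 31 + dag-n24-w1's III).  THEOREMS ONLY, def-free, sorry-free, standard axioms.
HONEST FRAMING: elementary re-lettering of DISPLAYED hypothesis families; nothing of Bałaban's asserted; no letter of NODE O is proved for `betaOfRecord₁₃`; K0⁷ ∕ K1⁷ NOT closed; no stub closed;
N24 COMPOSITE — no discharge, no count moved (5∕27 · A 5∕28); one finite 𝕋⁴ programme at fixed ε; R4 = the conditional finite-𝕋⁴ rung `BalabanLadder.UV` only — NOT continuum ∕ ℝ⁴ ∕ OS ∕ mass gap ∕ Clay.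
-/

noncomputable section

open scoped BigOperators

namespace Summit.QuantumFields.YangMills.BalabanUVNodes.N24NodeOLetterFamiliesLadder

open Literature.MathematicalPhysics.QuantumFieldTheory.Balaban1983to89
open Literature.MathematicalPhysics.QuantumFieldTheory.Balaban1983to89.Node00
open DagBinding T4Continuum FlowStepRuns
open FlowStep (HBeta RGEqH prefixOf BetaLowerH BetaUpperH Box mem_box)
open Summit.QuantumFields.YangMills.BalabanUVNodes.N24K1OfStubsV19ChildrenSplitPSFloorWorldBuilt (psFloor_zero_of_betaLowerH_zero)
open Summit.QuantumFields.YangMills.BalabanUVNodes.N24K1OfChildrenSplitNoShrinkLettersWorldBuilt (N24_noShrinkLetters_of_psFloorLetters_theta13OfThm1CCMW)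
open Summit.QuantumFields.YangMills.Theorems.K1NodeOLadderRunwiseSlackUniform (slackUniformNoShrink_of_psFloor exists_noHalving_of_slackUniformNoShrink)

variable {F : T4Family}

/-- **EDGE 1 — POSITIVE BOX FLOOR ⟹ SIGN** (Part 23's `hOF` ∃ b > 0 ⟹ Part 27's `hsignF`): a floor `b ≤ β` with `b > 0` on `]0, γO]^{k+1}` is in particular the sign `0 ≤ β` there (`BetaLowerH` is monotone in its floor letter — its definition). [cite: Balaban1988Convergent, (2.6) p.255 (elementary); Balaban1987RG1, (0.20) p.256, Thm 2 p.259, (1.22) p.264, (5.10) p.293; Balaban1988RG2Cluster, (2.41) p.21 (bookkeeping)] -/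
theorem N24_betaSignLetters_of_boxFloorLetters_theta13OfThm1CCMW
    (hOF : ∀ {j c : ℕ} {γ ε₀ ε₂₉ B₃ B₃' a₀ a₁ : ℝ} (hγ₀ : 0 < γ) (hγh : γ ≤ 1 / 2) (hε : 0 < ε₀) (hε' : 0 < ε₂₉) (hB : 0 ≤ B₃) (hB' : 0 ≤ B₃') (ha₀ : 0 < a₀) (ha₁ : 0 < a₁) (h15 : VariationalThm1RegSepCoP7M F 2 B₃ a₀ a₁) (hc : c ≤ F.L ^ j) (h9 : Gauge9RegSepTopStepR F 2 (fun ν K Ω => suppDomOfRecord F ν K Ω) (F.L ^ j) c B₃ B₃' a₀ a₁) {bl β' : ℝ} (hbox : BetaLowerH bl γ (betaOfRecord₁₃ F 2 (theta13OfThm1CCMW F 2 j γ ε₀ ε₂₉ B₃ B₃' a₀ a₁))) (hbox' : BetaUpperH β' γ (betaOfRecord₁₃ F 2 (theta13OfThm1CCMW F 2 j γ ε₀ ε₂₉ B₃ B₃' a₀ a₁))) (hl : -bl * γ ^ 2 ≤ 3) (hβ' : β' * γ ^ 2 ≤ 3 / 4),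
      ∃ b : ℝ, 0 < b ∧ ∃ γO : ℝ, 0 < γO ∧ BetaLowerH b γO (betaOfRecord₁₃ F 2 (theta13OfThm1CCMW F 2 j γ ε₀ ε₂₉ B₃ B₃' a₀ a₁))) :
    ∀ {j c : ℕ} {γ ε₀ ε₂₉ B₃ B₃' a₀ a₁ : ℝ} (hγ₀ : 0 < γ) (hγh : γ ≤ 1 / 2) (hε : 0 < ε₀) (hε' : 0 < ε₂₉) (hB : 0 ≤ B₃) (hB' : 0 ≤ B₃') (ha₀ : 0 < a₀) (ha₁ : 0 < a₁) (h15 : VariationalThm1RegSepCoP7M F 2 B₃ a₀ a₁) (hc : c ≤ F.L ^ j) (h9 : Gauge9RegSepTopStepR F 2 (fun ν K Ω => suppDomOfRecord F ν K Ω) (F.L ^ j) c B₃ B₃' a₀ a₁) {bl β' : ℝ} (hbox : BetaLowerH bl γ (betaOfRecord₁₃ F 2 (theta13OfThm1CCMW F 2 j γ ε₀ ε₂₉ B₃ B₃' a₀ a₁))) (hbox' : BetaUpperH β' γ (betaOfRecord₁₃ F 2 (theta13OfThm1CCMW F 2 j γ ε₀ ε₂₉ B₃ B₃' a₀ a₁)))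 (hl : -bl * γ ^ 2 ≤ 3) (hβ' : β' * γ ^ 2 ≤ 3 / 4),
      ∃ γO : ℝ, 0 < γO ∧ BetaLowerH 0 γO (betaOfRecord₁₃ F 2 (theta13OfThm1CCMW F 2 j γ ε₀ ε₂₉ B₃ B₃' a₀ a₁)) := by
  intro j c γ ε₀ ε₂₉ B₃ B₃' a₀ a₁ hγ₀ hγh hε hε' hB hB' ha₀ ha₁ h15 hc h9 bl β' hbox hbox' hl hβ'
  obtain ⟨b, hb, γO, hγO, hlo⟩ := hOF hγ₀ hγh hε hε' hB hB' ha₀ ha₁ h15 hc h9 hbox hbox' hl hβ'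
  exact ⟨γO, hγO, fun k v hv => hb.le.trans (hlo k v hv)⟩

/-- **EDGE 2 — SIGN ⟹ RUN-WISE PARTIAL-SUM FLOOR** (Part 27's `hsignF` ⟹ Part 26's `hpsF` with `M := 0`: Part 26 §0 `psFloor_zero_of_betaLowerH_zero` — the edge Part 27 used inline, here as a family theorem). [cite: Balaban1988Convergent, (2.6) p.255 (elementary); Balaban1987RG1, (0.20) p.256, Thm 2 p.259, (1.22) p.264, (5.10) p.293; Balaban1988RG2Cluster, (2.41) p.21 (bookkeeping)] -/
theorem N24_psFloorLetters_of_betaSignLetters_theta13OfThm1CCMW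
    (hsignF : ∀ {j c : ℕ} {γ ε₀ ε₂₉ B₃ B₃' a₀ a₁ : ℝ} (hγ₀ : 0 < γ) (hγh : γ ≤ 1 / 2) (hε : 0 < ε₀) (hε' : 0 < ε₂₉) (hB : 0 ≤ B₃) (hB' : 0 ≤ B₃') (ha₀ : 0 < a₀) (ha₁ : 0 < a₁) (h15 : VariationalThm1RegSepCoP7M F 2 B₃ a₀ a₁) (hc : c ≤ F.L ^ j) (h9 : Gauge9RegSepTopStepR F 2 (fun ν K Ω => suppDomOfRecord F ν K Ω) (F.L ^ j) c B₃ B₃' a₀ a₁) {bl β' : ℝ} (hbox : BetaLowerH bl γ (betaOfRecord₁₃ F 2 (theta13OfThm1CCMW F 2 j γ ε₀ ε₂₉ B₃ B₃' a₀ a₁))) (hbox' : BetaUpperH β' γ (betaOfRecord₁₃ F 2 (theta13OfThm1CCMW F 2 j γ ε₀ ε₂₉ B₃ B₃' a₀ a₁))) (hl : -bl * γ ^ 2 ≤ 3) (hβ' : β' * γ ^ 2 ≤ 3 / 4),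
      ∃ γO : ℝ, 0 < γO ∧ BetaLowerH 0 γO (betaOfRecord₁₃ F 2 (theta13OfThm1CCMW F 2 j γ ε₀ ε₂₉ B₃ B₃' a₀ a₁))) :
    ∀ {j c : ℕ} {γ ε₀ ε₂₉ B₃ B₃' a₀ a₁ : ℝ} (hγ₀ : 0 < γ) (hγh : γ ≤ 1 / 2) (hε : 0 < ε₀) (hε' : 0 < ε₂₉) (hB : 0 ≤ B₃) (hB' : 0 ≤ B₃') (ha₀ : 0 < a₀) (ha₁ : 0 < a₁) (h15 : VariationalThm1RegSepCoP7M F 2 B₃ a₀ a₁) (hc : c ≤ F.L ^ j) (h9 : Gauge9RegSepTopStepR F 2 (fun ν K Ω => suppDomOfRecord F ν K Ω) (F.L ^ j) c B₃ B₃' a₀ a₁) {bl β' : ℝ} (hbox : BetaLowerH bl γ (betaOfRecord₁₃ F 2 (theta13OfThm1CCMW F 2 j γ ε₀ ε₂₉ B₃ B₃' a₀ a₁))) (hbox' : BetaUpperH β' γ (betaOfRecord₁₃ F 2 (theta13OfThm1CCMW F 2 j γ ε₀ ε₂₉ B₃ B₃' a₀ a₁))) (hl : -bl * γ ^ 2 ≤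 3) (hβ' : β' * γ ^ 2 ≤ 3 / 4),
      ∃ γR M : ℝ, 0 < γR ∧ ∀ (n : ℕ) (gs : ℕ → ℝ), RGEqH n (betaOfRecord₁₃ F 2 (theta13OfThm1CCMW F 2 j γ ε₀ ε₂₉ B₃ B₃' a₀ a₁)) gs → Step.InInterval γR n gs →
        ∀ k, k ≤ n → -M ≤ ∑ i ∈ Finset.Ico k n, betaOfRecord₁₃ F 2 (theta13OfThm1CCMW F 2 j γ ε₀ ε₂₉ B₃ B₃' a₀ a₁) i (prefixOf gs i) := by
  intro j c γ ε₀ ε₂₉ B₃ B₃' a₀ a₁ hγ₀ hγh hε hε' hB hB' ha₀ ha₁ h15 hc h9 bl β' hbox hbox' hl hβ'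
  obtain ⟨γO, hγO, hsign⟩ := hsignF hγ₀ hγh hε hε' hB hB' ha₀ ha₁ h15 hc h9 hbox hbox' hl hβ'
  exact ⟨γO, 0, hγO, psFloor_zero_of_betaLowerH_zero hsign⟩

/-- **EDGE 3 — PARTIAL-SUM FLOOR ⟹ SLACK-UNIFORM NO-SHRINK `L*`** (for EVERY factor `β₀ > 0` SOME level: dag-n24-w1 g3's `K1NodeOLadderRunwiseSlackUniform.slackUniformNoShrink_of_psFloor`, p613002, BY NAME; the level bound `γ₀ ≤ γR` dropped).  `L*` sits strictly between Part 26's PS floor and Part 30's no-halving (their `absBox_slackUniformNoShrink_not_psFloor` ∕ `absBox_noHalvingEverywhere_not_slackUniform`). [cite: Balaban1988Convergent, (2.6) p.255 (elementary); Balaban1987RG1, (0.20) p.256, Thm 2 p.259, (1.22) p.264, (5.10) p.293; Balaban1988RG2Cluster, (2.41) p.21 (bookkeeping)] -/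
theorem N24_slackUniformLetters_of_psFloorLetters_theta13OfThm1CCMW
    (hpsF : ∀ {j c : ℕ} {γ ε₀ ε₂₉ B₃ B₃' a₀ a₁ : ℝ} (hγ₀ : 0 < γ) (hγh : γ ≤ 1 / 2) (hε : 0 < ε₀) (hε' : 0 < ε₂₉) (hB : 0 ≤ B₃) (hB' : 0 ≤ B₃') (ha₀ : 0 < a₀) (ha₁ : 0 < a₁) (h15 : VariationalThm1RegSepCoP7M F 2 B₃ a₀ a₁) (hc : c ≤ F.L ^ j) (h9 : Gauge9RegSepTopStepR F 2 (fun ν K Ω => suppDomOfRecord F ν K Ω) (F.L ^ j) c B₃ B₃' a₀ a₁) {bl β' : ℝ} (hbox : BetaLowerH bl γ (betaOfRecord₁₃ F 2 (theta13OfThm1CCMW F 2 j γ ε₀ ε₂₉ B₃ B₃' a₀ a₁))) (hbox' : BetaUpperH β' γ (betaOfRecord₁₃ F 2 (theta13OfThm1CCMW F 2 j γ ε₀ ε₂₉ B₃ B₃' a₀ a₁))) (hl : -bl * γ ^ 2 ≤ 3) (hβ' : β' * γ ^ 2 ≤ 3 / 4),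
      ∃ γR M : ℝ, 0 < γR ∧ ∀ (n : ℕ) (gs : ℕ → ℝ), RGEqH n (betaOfRecord₁₃ F 2 (theta13OfThm1CCMW F 2 j γ ε₀ ε₂₉ B₃ B₃' a₀ a₁)) gs → Step.InInterval γR n gs →
        ∀ k, k ≤ n → -M ≤ ∑ i ∈ Finset.Ico k n, betaOfRecord₁₃ F 2 (theta13OfThm1CCMW F 2 j γ ε₀ ε₂₉ B₃ B₃' a₀ a₁) i (prefixOf gs i)) :
    ∀ {j c : ℕ} {γ ε₀ ε₂₉ B₃ B₃' a₀ a₁ : ℝ} (hγ₀ : 0 < γ) (hγh : γ ≤ 1 / 2) (hε : 0 < ε₀) (hε' : 0 < ε₂₉) (hB : 0 ≤ B₃) (hB' : 0 ≤ B₃') (ha₀ : 0 < a₀) (ha₁ : 0 < a₁) (h15 : VariationalThm1RegSepCoP7M F 2 B₃ a₀ a₁) (hc : c ≤ F.L ^ j) (h9 : Gauge9RegSepTopStepR F 2 (fun ν K Ω => suppDomOfRecord F ν K Ω) (F.L ^ j) c B₃ B₃' a₀ a₁) {bl β' : ℝ} (hbox : BetaLowerH bl γ (betaOfRecord₁₃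 F 2 (theta13OfThm1CCMW F 2 j γ ε₀ ε₂₉ B₃ B₃' a₀ a₁))) (hbox' : BetaUpperH β' γ (betaOfRecord₁₃ F 2 (theta13OfThm1CCMW F 2 j γ ε₀ ε₂₉ B₃ B₃' a₀ a₁))) (hl : -bl * γ ^ 2 ≤ 3) (hβ' : β' * γ ^ 2 ≤ 3 / 4),
      ∀ β₀ : ℝ, 0 < β₀ → ∃ γ₀ : ℝ, 0 < γ₀ ∧ ∀ (n : ℕ) (gs : ℕ → ℝ), RGEqH n (betaOfRecord₁₃ F 2 (theta13OfThm1CCMW F 2 j γ ε₀ ε₂₉ B₃ B₃' a₀ a₁)) gs → Step.InInterval γ₀ n gs →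
        ∀ m n', m < n' → n' ≤ n → gs m ≤ (1 + β₀) * gs n' := by
  intro j c γ ε₀ ε₂₉ B₃ B₃' a₀ a₁ hγ₀ hγh hε hε' hB hB' ha₀ ha₁ h15 hc h9 bl β' hbox hbox' hl hβ'
  obtain ⟨γR, M, hγR, hps⟩ := hpsF hγ₀ hγh hε hε' hB hB' ha₀ ha₁ h15 hc h9 hbox hbox' hl hβ'
  intro β₀ hβ₀
  obtain ⟨γ₀, hγ₀', -, h⟩ := slackUniformNoShrink_of_psFloor hγR hps β₀ hβ₀
  exact ⟨γ₀, hγ₀', h⟩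

/-- **EDGE 4 — `L*` ⟹ NO-HALVING** (slack `β₀ := 1`: dag-n24-w1's `exists_noHalving_of_slackUniformNoShrink`, BY NAME; conclusion = Part 30's `hnhF` body). [cite: Balaban1988Convergent, (2.6) p.255 (elementary); Balaban1987RG1, (0.20) p.256, Thm 2 p.259, (1.22) p.264, (5.10) p.293; Balaban1988RG2Cluster, (2.41) p.21 (bookkeeping)] -/
theorem N24_noHalvingLetters_of_slackUniformLetters_theta13OfThm1CCMW
    (hLF : ∀ {j c : ℕ} {γ ε₀ ε₂₉ B₃ B₃' a₀ a₁ : ℝ} (hγ₀ : 0 < γ) (hγh : γ ≤ 1 / 2) (hε : 0 < ε₀) (hε' : 0 < ε₂₉) (hB : 0 ≤ B₃) (hB' : 0 ≤ B₃') (ha₀ : 0 < a₀) (ha₁ : 0 < a₁) (h15 : VariationalThm1RegSepCoP7M F 2 B₃ a₀ a₁) (hc : c ≤ F.L ^ j) (h9 : Gauge9RegSepTopStepR F 2 (fun ν K Ω => suppDomOfRecord F ν K Ω) (F.L ^ j) c B₃ B₃' a₀ a₁) {bl β' : ℝ} (hbox : BetaLowerH bl γ (betaOfRecord₁₃ F 2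 (theta13OfThm1CCMW F 2 j γ ε₀ ε₂₉ B₃ B₃' a₀ a₁))) (hbox' : BetaUpperH β' γ (betaOfRecord₁₃ F 2 (theta13OfThm1CCMW F 2 j γ ε₀ ε₂₉ B₃ B₃' a₀ a₁))) (hl : -bl * γ ^ 2 ≤ 3) (hβ' : β' * γ ^ 2 ≤ 3 / 4),
      ∀ β₀ : ℝ, 0 < β₀ → ∃ γ₀ : ℝ, 0 < γ₀ ∧ ∀ (n : ℕ) (gs : ℕ → ℝ), RGEqH n (betaOfRecord₁₃ F 2 (theta13OfThm1CCMW F 2 j γ ε₀ ε₂₉ B₃ B₃' a₀ a₁)) gs → Step.InInterval γ₀ n gs →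
        ∀ m n', m < n' → n' ≤ n → gs m ≤ (1 + β₀) * gs n') :
    ∀ {j c : ℕ} {γ ε₀ ε₂₉ B₃ B₃' a₀ a₁ : ℝ} (hγ₀ : 0 < γ) (hγh : γ ≤ 1 / 2) (hε : 0 < ε₀) (hε' : 0 < ε₂₉) (hB : 0 ≤ B₃) (hB' : 0 ≤ B₃') (ha₀ : 0 < a₀) (ha₁ : 0 < a₁) (h15 : VariationalThm1RegSepCoP7M F 2 B₃ a₀ a₁) (hc : c ≤ F.L ^ j) (h9 : Gauge9RegSepTopStepR F 2 (fun ν K Ω => suppDomOfRecord F ν K Ω) (F.L ^ j) c B₃ B₃' a₀ a₁) {bl β' : ℝ} (hbox : BetaLowerH bl γ (betaOfRecord₁₃ F 2 (theta13OfThm1CCMW F 2 j γ ε₀ ε₂₉ B₃ B₃' a₀ a₁))) (hbox' : BetaUpperH β' γ (betaOfRecord₁₃ F 2 (theta13OfThm1CCMW F 2 j γ ε₀ ε₂₉ B₃ B₃' a₀ a₁))) (hl : -bl * γ ^ 2 ≤ 3) (hβ' : β' * γ ^ 2 ≤ 3 / 4),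
      ∃ γ₀ : ℝ, 0 < γ₀ ∧ ∀ (n : ℕ) (gs : ℕ → ℝ), RGEqH n (betaOfRecord₁₃ F 2 (theta13OfThm1CCMW F 2 j γ ε₀ ε₂₉ B₃ B₃' a₀ a₁)) gs → Step.InInterval γ₀ n gs →
        ∀ m n', m < n' → n' ≤ n → gs m ≤ (1 + 1) * gs n' := by
  intro j c γ ε₀ ε₂₉ B₃ B₃' a₀ a₁ hγ₀ hγh hε hε' hB hB' ha₀ ha₁ h15 hc h9 bl β' hbox hbox' hl hβ'
  exact exists_noHalving_of_slackUniformNoShrink (hLF hγ₀ hγh hε hε' hB hB' ha₀ ha₁ h15 hc h9 hbox hbox' hl hβ')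

/-- **EDGE 4′ — `L*` ⟹ ∃-FACTOR NO-SHRINK** (Part 31's bottom rung `hnsF`; slack `1`). [cite: Balaban1988Convergent, (2.6) p.255 (elementary); Balaban1987RG1, (0.20) p.256, Thm 2 p.259, (1.22) p.264, (5.10) p.293; Balaban1988RG2Cluster, (2.41) p.21 (bookkeeping)] -/
theorem N24_noShrinkLetters_of_slackUniformLetters_theta13OfThm1CCMW
    (hLF : ∀ {j c : ℕ} {γ ε₀ ε₂₉ B₃ B₃' a₀ a₁ : ℝ} (hγ₀ : 0 < γ) (hγh : γ ≤ 1 / 2) (hε : 0 < ε₀) (hε' : 0 < ε₂₉) (hB : 0 ≤ B₃) (hB' : 0 ≤ B₃') (ha₀ : 0 < a₀) (ha₁ : 0 < a₁) (h15 : VariationalThm1RegSepCoP7M F 2 B₃ a₀ a₁) (hc : c ≤ F.L ^ j) (h9 : Gauge9RegSepTopStepR F 2 (fun ν K Ω => suppDomOfRecord F ν K Ω) (F.L ^ j) c B₃ B₃' a₀ a₁) {bl β' : ℝ} (hbox : BetaLowerH bl γ (betaOfRecord₁₃ F 2 (theta13OfThm1CCMW F 2 j γ ε₀ ε₂₉ B₃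 B₃' a₀ a₁))) (hbox' : BetaUpperH β' γ (betaOfRecord₁₃ F 2 (theta13OfThm1CCMW F 2 j γ ε₀ ε₂₉ B₃ B₃' a₀ a₁))) (hl : -bl * γ ^ 2 ≤ 3) (hβ' : β' * γ ^ 2 ≤ 3 / 4),
      ∀ β₀ : ℝ, 0 < β₀ → ∃ γ₀ : ℝ, 0 < γ₀ ∧ ∀ (n : ℕ) (gs : ℕ → ℝ), RGEqH n (betaOfRecord₁₃ F 2 (theta13OfThm1CCMW F 2 j γ ε₀ ε₂₉ B₃ B₃' a₀ a₁)) gs → Step.InInterval γ₀ n gs →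
        ∀ m n', m < n' → n' ≤ n → gs m ≤ (1 + β₀) * gs n') :
    ∀ {j c : ℕ} {γ ε₀ ε₂₉ B₃ B₃' a₀ a₁ : ℝ} (hγ₀ : 0 < γ) (hγh : γ ≤ 1 / 2) (hε : 0 < ε₀) (hε' : 0 < ε₂₉) (hB : 0 ≤ B₃) (hB' : 0 ≤ B₃') (ha₀ : 0 < a₀) (ha₁ : 0 < a₁) (h15 : VariationalThm1RegSepCoP7M F 2 B₃ a₀ a₁) (hc : c ≤ F.L ^ j) (h9 : Gauge9RegSepTopStepR F 2 (fun ν K Ω => suppDomOfRecord F ν K Ω) (F.L ^ j) c B₃ B₃' a₀ a₁) {bl β' : ℝ} (hbox : BetaLowerH bl γ (betaOfRecord₁₃ F 2 (theta13OfThm1CCMW F 2 j γ ε₀ ε₂₉ B₃ B₃' a₀ a₁))) (hbox' : BetaUpperH β' γ (betaOfRecord₁₃ F 2 (theta13OfThm1CCMW F 2 j γ ε₀ ε₂₉ B₃ B₃' a₀ a₁))) (hl : -bl * γ ^ 2 ≤ 3) (hβ' : β' * γ ^ 2 ≤ 3 / 4),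
      ∃ β₀ γ₀ : ℝ, 0 < β₀ ∧ 0 < γ₀ ∧ ∀ (n : ℕ) (gs : ℕ → ℝ), RGEqH n (betaOfRecord₁₃ F 2 (theta13OfThm1CCMW F 2 j γ ε₀ ε₂₉ B₃ B₃' a₀ a₁)) gs → Step.InInterval γ₀ n gs →
        ∀ m n', m < n' → n' ≤ n → gs m ≤ (1 + β₀) * gs n' := by
  intro j c γ ε₀ ε₂₉ B₃ B₃' a₀ a₁ hγ₀ hγh hε hε' hB hB' ha₀ ha₁ h15 hc h9 bl β' hbox hbox' hl hβ'
  obtain ⟨γ₀, hγ₀', h⟩ := hLF hγ₀ hγh hε hε' hB hB' ha₀ ha₁ h15 hc h9 hbox hbox' hl hβ' 1 one_pos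
  exact ⟨1, γ₀, one_pos, hγ₀', h⟩

/-- **COMPOSITE — SIGN ⟹ ∃-FACTOR NO-SHRINK** (edges 2 ∘ Part 31 §5 `N24_noShrinkLetters_of_psFloorLetters_theta13OfThm1CCMW`): Part 27's sign road reaches every no-shrink closer (Part 31 §2–§4, Part 32's P₂C + mixed-W road) BY NAME. [cite: Balaban1988Convergent, (2.6) p.255 (elementary); Balaban1987RG1, (0.20) p.256, Thm 2 p.259, (1.22) p.264, (5.10) p.293; Balaban1988RG2Cluster, (2.41) p.21 (bookkeeping)] -/
theorem N24_noShrinkLetters_of_betaSignLetters_theta13OfThm1CCMW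
    (hsignF : ∀ {j c : ℕ} {γ ε₀ ε₂₉ B₃ B₃' a₀ a₁ : ℝ} (hγ₀ : 0 < γ) (hγh : γ ≤ 1 / 2) (hε : 0 < ε₀) (hε' : 0 < ε₂₉) (hB : 0 ≤ B₃) (hB' : 0 ≤ B₃') (ha₀ : 0 < a₀) (ha₁ : 0 < a₁) (h15 : VariationalThm1RegSepCoP7M F 2 B₃ a₀ a₁) (hc : c ≤ F.L ^ j) (h9 : Gauge9RegSepTopStepR F 2 (fun ν K Ω => suppDomOfRecord F ν K Ω) (F.L ^ j) c B₃ B₃' a₀ a₁) {bl β' : ℝ} (hbox : BetaLowerH bl γ (betaOfRecord₁₃ F 2 (theta13OfThm1CCMW F 2 j γ ε₀ ε₂₉ B₃ B₃' a₀ a₁))) (hbox' : BetaUpperH β' γ (betaOfRecord₁₃ F 2 (theta13OfThm1CCMW F 2 j γ ε₀ ε₂₉ B₃ B₃' a₀ a₁))) (hl : -bl * γ ^ 2 ≤ 3) (hβ' : β' * γ ^ 2 ≤ 3 / 4),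
      ∃ γO : ℝ, 0 < γO ∧ BetaLowerH 0 γO (betaOfRecord₁₃ F 2 (theta13OfThm1CCMW F 2 j γ ε₀ ε₂₉ B₃ B₃' a₀ a₁))) :
    ∀ {j c : ℕ} {γ ε₀ ε₂₉ B₃ B₃' a₀ a₁ : ℝ} (hγ₀ : 0 < γ) (hγh : γ ≤ 1 / 2) (hε : 0 < ε₀) (hε' : 0 < ε₂₉) (hB : 0 ≤ B₃) (hB' : 0 ≤ B₃') (ha₀ : 0 < a₀) (ha₁ : 0 < a₁) (h15 : VariationalThm1RegSepCoP7M F 2 B₃ a₀ a₁) (hc : c ≤ F.L ^ j) (h9 : Gauge9RegSepTopStepR F 2 (fun ν K Ω => suppDomOfRecord F ν K Ω) (F.L ^ j) c B₃ B₃' a₀ a₁) {bl β' : ℝ} (hbox : BetaLowerH bl γ (betaOfRecord₁₃ F 2 (theta13OfThm1CCMW F 2 j γ ε₀ ε₂₉ B₃ B₃' a₀ a₁))) (hbox' : BetaUpperH β' γ (betaOfRecord₁₃ F 2 (theta13OfThm1CCMW F 2 j γ ε₀ ε₂₉ B₃ B₃' a₀ a₁))) (hl : -bl * γ ^ 2 ≤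 3) (hβ' : β' * γ ^ 2 ≤ 3 / 4),
      ∃ β₀ γ₀ : ℝ, 0 < β₀ ∧ 0 < γ₀ ∧ ∀ (n : ℕ) (gs : ℕ → ℝ), RGEqH n (betaOfRecord₁₃ F 2 (theta13OfThm1CCMW F 2 j γ ε₀ ε₂₉ B₃ B₃' a₀ a₁)) gs → Step.InInterval γ₀ n gs →
        ∀ m n', m < n' → n' ≤ n → gs m ≤ (1 + β₀) * gs n' := by
  intro j c γ ε₀ ε₂₉ B₃ B₃' a₀ a₁ hγ₀ hγh hε hε' hB hB' ha₀ ha₁ h15 hc h9 bl β' hbox hbox' hl hβ'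
  exact N24_noShrinkLetters_of_psFloorLetters_theta13OfThm1CCMW (N24_psFloorLetters_of_betaSignLetters_theta13OfThm1CCMW hsignF) hγ₀ hγh hε hε' hB hB' ha₀ ha₁ h15 hc h9 hbox hbox' hl hβ'

/-- **COMPOSITE — POSITIVE BOX FLOOR ⟹ ∃-FACTOR NO-SHRINK** (edges 1 ∘ 2 ∘ Part 31 §5): Part 23's floor road reaches every no-shrink closer BY NAME — the full ladder box floor ⟹ sign ⟹ PS floor ⟹ `L*` ⟹ no-halving ⟹ no-shrink is tree text, family-wise at the witness door, reading NO child (N05's slot and N12's pin never enter). [cite: Balaban1988Convergent, (2.6) p.255 (elementary); Balaban1987RG1, (0.20) p.256, Thm 2 p.259, (1.22) p.264, (5.10) p.293; Balaban1988RG2Cluster, (2.41) p.21 (bookkeeping)] -/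
theorem N24_noShrinkLetters_of_boxFloorLetters_theta13OfThm1CCMW
    (hOF : ∀ {j c : ℕ} {γ ε₀ ε₂₉ B₃ B₃' a₀ a₁ : ℝ} (hγ₀ : 0 < γ) (hγh : γ ≤ 1 / 2) (hε : 0 < ε₀) (hε' : 0 < ε₂₉) (hB : 0 ≤ B₃) (hB' : 0 ≤ B₃') (ha₀ : 0 < a₀) (ha₁ : 0 < a₁) (h15 : VariationalThm1RegSepCoP7M F 2 B₃ a₀ a₁) (hc : c ≤ F.L ^ j) (h9 : Gauge9RegSepTopStepR F 2 (fun ν K Ω => suppDomOfRecord F ν K Ω) (F.L ^ j) c B₃ B₃' a₀ a₁) {bl β' : ℝ} (hbox : BetaLowerH bl γ (betaOfRecord₁₃ F 2 (theta13OfThm1CCMW F 2 j γ ε₀ ε₂₉ B₃ B₃' a₀ a₁))) (hbox' : BetaUpperH β' γ (betaOfRecord₁₃ F 2 (theta13OfThm1CCMW F 2 j γ ε₀ ε₂₉ B₃ B₃' a₀ a₁))) (hl : -bl * γ ^ 2 ≤ 3) (hβ' : β' * γ ^ 2 ≤ 3 / 4),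
      ∃ b : ℝ, 0 < b ∧ ∃ γO : ℝ, 0 < γO ∧ BetaLowerH b γO (betaOfRecord₁₃ F 2 (theta13OfThm1CCMW F 2 j γ ε₀ ε₂₉ B₃ B₃' a₀ a₁))) :
    ∀ {j c : ℕ} {γ ε₀ ε₂₉ B₃ B₃' a₀ a₁ : ℝ} (hγ₀ : 0 < γ) (hγh : γ ≤ 1 / 2) (hε : 0 < ε₀) (hε' : 0 < ε₂₉) (hB : 0 ≤ B₃) (hB' : 0 ≤ B₃') (ha₀ : 0 < a₀) (ha₁ : 0 < a₁) (h15 : VariationalThm1RegSepCoP7M F 2 B₃ a₀ a₁) (hc : c ≤ F.L ^ j) (h9 : Gauge9RegSepTopStepR F 2 (fun ν K Ω => suppDomOfRecord F ν K Ω) (F.L ^ j) c B₃ B₃' a₀ a₁) {bl β' : ℝ} (hbox : BetaLowerH bl γ (betaOfRecord₁₃ F 2 (theta13OfThm1CCMW F 2 j γ ε₀ ε₂₉ B₃ B₃' a₀ a₁))) (hbox' : BetaUpperH β' γ (betaOfRecord₁₃ F 2 (theta13OfThm1CCMW F 2 j γ ε₀ ε₂₉ B₃ B₃' a₀ a₁)))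 (hl : -bl * γ ^ 2 ≤ 3) (hβ' : β' * γ ^ 2 ≤ 3 / 4),
      ∃ β₀ γ₀ : ℝ, 0 < β₀ ∧ 0 < γ₀ ∧ ∀ (n : ℕ) (gs : ℕ → ℝ), RGEqH n (betaOfRecord₁₃ F 2 (theta13OfThm1CCMW F 2 j γ ε₀ ε₂₉ B₃ B₃' a₀ a₁)) gs → Step.InInterval γ₀ n gs →
        ∀ m n', m < n' → n' ≤ n → gs m ≤ (1 + β₀) * gs n' := by
  intro j c γ ε₀ ε₂₉ B₃ B₃' a₀ a₁ hγ₀ hγh hε hε' hB hB' ha₀ ha₁ h15 hc h9 bl β' hbox hbox' hl hβ'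
  exact N24_noShrinkLetters_of_betaSignLetters_theta13OfThm1CCMW (N24_betaSignLetters_of_boxFloorLetters_theta13OfThm1CCMW hOF) hγ₀ hγh hε hε' hB hB' ha₀ ha₁ h15 hc h9 hbox hbox' hl hβ'

end Summit.QuantumFields.YangMills.BalabanUVNodes.N24NodeOLetterFamiliesLadder

end
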